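import Literature.Computability.Cryptography.HallgrenClassGroupQuantumEstimates
import Literature.Computability.Cryptography.HallgrenClassGroupCharacterSums
import Literature.Computability.Cryptography.HallgrenClassGroupGeneration
import HarnessLib

/-!
# Hallgren 2005 / class numbers under GRH — step Q2d (ii): success probability of the experiment

Topic `Literature/Computability/Cryptography`; proof companion of `HallgrenClassGroup.lean`
(named fact `Hallgren2005_classNumber_qsolvable_of_GRH`). Theorems only; no named fact. Sequel of
`HallgrenClassGroupQuantumEstimates.lean` (the deterministic half): here the probabilistic half of
the analysis of Kitaev's experiment for the order of `G = ⟨g_1, …, g_K⟩`,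

* `sum_not_clAccurate_le` / `sum_clAccurate_ge` — under every `ψ ∈ Ĝ^T` the inaccurate read-outs
  have product weight `≤ 1/12` (Chebyshev per block, `chebyshev_block`, union bound over the
  `clNumBlocks ℓ` blocks of size `768 (clNumBlocks ℓ + 1)`);
* `card_closure_ne_top_mul_le` — **few tuples fail to generate**: for a finite abelian group `H`,
  `#{ψ ∈ H^T : ⟨ψ⟩ ≠ H} · 2^T ≤ #Sub(H) · |H|^T` (a non-generating tuple lies in a proper subgroup,
  of index `≥ 2`); `card_addSubgroup_le` (`#Sub(H) ≤ (|H|+1)^{log₂|H|}`, from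
  `HallgrenClassGroupGeneration.card_subgroup_le`); `card_not_generating_le` — for `H = Ĝ`,
  `|G| < 4^ℓ` and `T = clTrials ℓ = 4ℓ² + 4`: `8 · #{bad ψ} ≤ |G|^T`;
* **`subgroupOrder_success`** — for a clean block `|x⟩|c⟩|0⟩ ↦ |x⟩|c⟩|R c⟩` whose work register
  separates exactly the trial sums `∑_{j ∈ trial t} c_j W_j ∈ G` (`W_j = 2^{l_j} g_{i_j}`), every set
  of read-outs containing the accurate read-outs of all generating `ψ` has Born probability
  `≥ (7/8)(11/12) = 77/96` (the law is `kitaevCircuit_distributionChar`).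

## References

* A. Yu. Kitaev, arXiv:quant-ph/9511026 (1995), §3 (before Lemma 9; Lemma 10), §4 [Kitaev1995].
* K. K. H. Cheung, M. Mosca, Quantum Inf. Comput. 1 (2001), §3 [CheungMosca2001].
* A. M. Childs, W. van Dam, Rev. Mod. Phys. 82 (2010), §IV.D, §5.7 [ChildsVandam2010].
-/

noncomputable section

namespace Literature.Computability.Cryptography.Hallgren2005

open Complex Finset Real Matrix Kitaev1995 QuantumComplexity

/-! ### Accurate read-outs are likely -/

section Accurate

variable {ℓ : ℕ} {G : Type*} [AddCommGroup G] (g : Fin (clSlots ℓ) → G)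
  (ψ : Fin (clTrials ℓ) → AddChar G ℂ)

/-- The number of blocks is `clNumBlocks ℓ`. [folklore] -/
theorem card_clBlk (ℓ : ℕ) : Fintype.card (ClBlk ℓ) = clNumBlocks ℓ := by
  simp only [Fintype.card_prod, Fintype.card_fin, Fintype.card_bool, clNumBlocks]

open scoped Classical in
/-- **Inaccurate read-outs are rare**: under every `ψ` the read-outs that are not accurate have
total weight `≤ 1/12`. [cite: Kitaev1995, §3 (before Lemma 9)] -/
theorem sum_not_clAccurate_le :
    ∑ γ ∈ univ.filter (fun γ => ¬ ClAccurate g ψ γ), ∏ j, clWeight g ψ j (γ j) ≤ 1 / 12 := by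
  classical
  have hB := clBlockSize_pos ℓ
  have hBr : (0 : ℝ) < clBlockSize ℓ := by exact_mod_cast hB
  have hsub : (univ.filter fun γ => ¬ ClAccurate g ψ γ) =
      univ.filter fun γ : Fin (clNumControls ℓ) → Bool => ∃ β : ClBlk ℓ,
        (clBlockSize ℓ : ℝ) / 16 ≤ |(clCnt β γ : ℝ) - ∑ j ∈ clBlock ℓ β, clWeight g ψ j true| := by
    refine filter_congr fun γ _ => ?_
    simp only [ClAccurate, not_forall, not_lt]
  rw [hsub]
  refine (sum_filter_exists_le _ (fun γ => prod_nonneg fun j _ => clWeight_nonneg g ψ j _) _).trans ?_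
  have hblock : ∀ β : ClBlk ℓ, ∑ γ ∈ univ.filter (fun γ : Fin (clNumControls ℓ) → Bool =>
      (clBlockSize ℓ : ℝ) / 16 ≤ |(clCnt β γ : ℝ) - ∑ j ∈ clBlock ℓ β, clWeight g ψ j true|),
        ∏ j, clWeight g ψ j (γ j) ≤ 64 / clBlockSize ℓ := by
    intro β
    have h := chebyshev_block (clWeight g ψ) (clWeight_nonneg g ψ)
      (clWeight_false_add_true g ψ) (clBlock ℓ β) (a := (clBlockSize ℓ : ℝ) / 16) (by positivity)
    rw [card_clBlock] at h
    refine (le_of_eq ?_).trans (h.trans (le_of_eq ?_))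
    · rfl
    · field_simp
      ring
  calc ∑ β : ClBlk ℓ, ∑ γ ∈ univ.filter (fun γ : Fin (clNumControls ℓ) → Bool =>
        (clBlockSize ℓ : ℝ) / 16 ≤ |(clCnt β γ : ℝ) - ∑ j ∈ clBlock ℓ β, clWeight g ψ j true|),
          ∏ j, clWeight g ψ j (γ j)
      ≤ ∑ _β : ClBlk ℓ, (64 : ℝ) / clBlockSize ℓ := sum_le_sum fun β _ => hblock β
    _ = (clNumBlocks ℓ : ℕ) * ((64 : ℝ) / clBlockSize ℓ) := by
        rw [sum_const, card_univ, card_clBlk, nsmul_eq_mul]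
    _ ≤ 1 / 12 := by
        simp only [clBlockSize, Nat.cast_mul, Nat.cast_ofNat, Nat.cast_add, Nat.cast_one]
        rw [div_eq_mul_inv, ← mul_assoc, ← div_eq_mul_inv,
          div_le_div_iff₀ (by positivity) (by positivity)]
        nlinarith [(Nat.cast_nonneg (clNumBlocks ℓ) : (0 : ℝ) ≤ clNumBlocks ℓ)]

open scoped Classical in
/-- **Accurate read-outs are likely**: total weight `≥ 11/12` under every `ψ`. [cite: Kitaev1995, §3 (before Lemma 9)] -/
theorem sum_clAccurate_ge :
    11 / 12 ≤ ∑ γ ∈ univ.filter (fun γ => ClAccurate g ψ γ), ∏ j, clWeight g ψ j (γ j) := by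
  classical
  have htot := sum_prodWeight (clWeight g ψ) (clWeight_false_add_true g ψ)
  rw [← sum_filter_add_sum_filter_not univ (fun γ => ClAccurate g ψ γ)] at htot
  have := sum_not_clAccurate_le g ψ
  linarith

end Accurate

/-! ### Few tuples fail to generate a finite abelian group -/

section Generate

variable {H : Type*} [AddCommGroup H] [Fintype H]

/-- The lattice of subgroups of a finite group is finite. [folklore] -/
theorem finite_addSubgroup : Finite (AddSubgroup H) :=
  Finite.of_injective (fun K : AddSubgroup H => (K : Set H)) SetLike.coe_injective

/-- `#Sub(H) ≤ (|H| + 1)^{⌊log₂ |H|⌋}` (additive form of `card_subgroup_le`). [folklore] -/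
theorem card_addSubgroup_le :
    Nat.card (AddSubgroup H) ≤ (Fintype.card H + 1) ^ Nat.log 2 (Fintype.card H) := by
  have h := card_subgroup_le (G := Multiplicative H)
  rw [Nat.card_congr (AddSubgroup.toSubgroup (A := H)).toEquiv]
  simpa [Nat.card_eq_fintype_card] using h

/-- A proper subgroup has at most half the elements. [folklore] -/
theorem two_mul_card_le_of_ne_top {K : AddSubgroup H} (hK : K ≠ ⊤) :
    2 * Nat.card K ≤ Nat.card H := by
  classical
  have hidx : K.index ≠ 1 := fun h => hK (AddSubgroup.index_eq_one.1 h)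
  have hidx0 : K.index ≠ 0 := AddSubgroup.index_ne_zero_of_finite
  have h2 : 2 ≤ K.index := by omega
  calc 2 * Nat.card K ≤ K.index * Nat.card K := Nat.mul_le_mul_right _ h2
    _ = Nat.card H := by rw [mul_comm]; exact K.card_mul_index

open scoped Classical in
/-- Tuples with all entries in `K` number `|K|^T`. [folklore] -/
theorem card_filter_forall_mem (K : AddSubgroup H) (T : ℕ) :
    (univ.filter fun ψ : Fin T → H => ∀ t, ψ t ∈ K).card = Nat.card K ^ T := by
  classical
  have : (univ.filter fun ψ : Fin T → H => ∀ t, ψ t ∈ K) =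
      univ.image fun φ : Fin T → K => fun t => (φ t : H) := by
    ext ψ
    simp only [mem_filter, mem_univ, true_and, mem_image]
    constructor
    · intro h; exact ⟨fun t => ⟨ψ t, h t⟩, rfl⟩
    · rintro ⟨φ, rfl⟩ t; exact (φ t).2
  rw [this, card_image_of_injective _ fun φ φ' h => funext fun t => Subtype.ext (congrFun h t)]
  simp [Nat.card_eq_fintype_card]

open scoped Classical in
/-- **Few tuples fail to generate**: `#{ψ ∈ H^T : ⟨ψ_1, …, ψ_T⟩ ≠ H} · 2^T ≤ #Sub(H) · |H|^T` — a
non-generating tuple lies in some proper subgroup `K` (`|K| ≤ |H|/2`), and there are `|K|^T` tuples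
in `K`. [cite: Kitaev1995, §4 (k random elements generate unless in a common maximal subgroup)] -/
theorem card_closure_ne_top_mul_le (T : ℕ) :
    (univ.filter fun ψ : Fin T → H => AddSubgroup.closure (Set.range ψ) ≠ ⊤).card * 2 ^ T ≤
      Nat.card (AddSubgroup H) * Fintype.card H ^ T := by
  classical
  haveI := finite_addSubgroup (H := H)
  haveI : Fintype (AddSubgroup H) := Fintype.ofFinite _
  -- cover by the proper subgroups
  have hcover : (univ.filter fun ψ : Fin T → H => AddSubgroup.closure (Set.range ψ) ≠ ⊤) ⊆
      (univ.filter fun K : AddSubgroup H => K ≠ ⊤).biUnion fun K =>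
        univ.filter fun ψ : Fin T → H => ∀ t, ψ t ∈ K := by
    intro ψ hψ
    simp only [mem_filter, mem_univ, true_and] at hψ
    simp only [mem_biUnion, mem_filter, mem_univ, true_and]
    exact ⟨AddSubgroup.closure (Set.range ψ), hψ, fun t => AddSubgroup.subset_closure ⟨t, rfl⟩⟩
  calc (univ.filter fun ψ : Fin T → H => AddSubgroup.closure (Set.range ψ) ≠ ⊤).card * 2 ^ T
      ≤ ((univ.filter fun K : AddSubgroup H => K ≠ ⊤).biUnion fun K =>
          univ.filter fun ψ : Fin T → H => ∀ t, ψ t ∈ K).card * 2 ^ T :=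
        Nat.mul_le_mul_right _ (card_le_card hcover)
    _ ≤ (∑ K ∈ univ.filter (fun K : AddSubgroup H => K ≠ ⊤),
          (univ.filter fun ψ : Fin T → H => ∀ t, ψ t ∈ K).card) * 2 ^ T :=
        Nat.mul_le_mul_right _ card_biUnion_le
    _ = ∑ K ∈ univ.filter (fun K : AddSubgroup H => K ≠ ⊤), Nat.card K ^ T * 2 ^ T := by
        rw [sum_mul]
        refine sum_congr rfl fun K _ => ?_
        congr 1
        convert card_filter_forall_mem K T
    _ ≤ ∑ _K ∈ univ.filter (fun K : AddSubgroup H => K ≠ ⊤), Fintype.card H ^ T := by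
        refine sum_le_sum fun K hK => ?_
        have h2 := two_mul_card_le_of_ne_top (mem_filter.1 hK).2
        rw [Nat.card_eq_fintype_card (α := H)] at h2
        calc Nat.card K ^ T * 2 ^ T = (Nat.card K * 2) ^ T := by rw [mul_pow]
          _ ≤ Fintype.card H ^ T := Nat.pow_le_pow_left (by omega) _
    _ = (univ.filter fun K : AddSubgroup H => K ≠ ⊤).card * Fintype.card H ^ T := by
        rw [sum_const, smul_eq_mul]
    _ ≤ Nat.card (AddSubgroup H) * Fintype.card H ^ T := by
        refine Nat.mul_le_mul_right _ ?_
        rw [Nat.card_eq_fintype_card]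
        exact card_filter_le _ _

end Generate

/-! ### The characters of `G`: few `T`-tuples fail to generate `Ĝ` -/

section Characters

variable {ℓ : ℕ} {G : Type*} [AddCommGroup G] [Fintype G]

/-- `2^{4ℓ²} · 8 ≤ 2^{clTrials ℓ}`. [folklore] -/
theorem pow_bound_clTrials (ℓ : ℕ) : (2 : ℕ) ^ (2 * ℓ * (2 * ℓ)) * 8 ≤ 2 ^ clTrials ℓ := by
  rw [clTrials, show (8 : ℕ) = 2 ^ 3 by norm_num, ← pow_add]
  exact Nat.pow_le_pow_right (by norm_num) (by nlinarith)

open scoped Classical in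
/-- **Few character tuples fail to generate `Ĝ`**: for `|G| < 4^ℓ` and `T = clTrials ℓ`,
`8 · #{ψ ∈ Ĝ^T : ⟨ψ⟩ ≠ Ĝ} ≤ |G|^T`. [cite: Kitaev1995, §4] -/
theorem card_not_generating_le (hG : Fintype.card G < clN ℓ) :
    8 * (univ.filter fun ψ : Fin (clTrials ℓ) → AddChar G ℂ =>
        AddSubgroup.closure (Set.range ψ) ≠ ⊤).card ≤ Fintype.card G ^ clTrials ℓ := by
  classical
  set T := clTrials ℓ
  set bad := (univ.filter fun ψ : Fin T → AddChar G ℂ => AddSubgroup.closure (Set.range ψ) ≠ ⊤).card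
  have hmain := card_closure_ne_top_mul_le (H := AddChar G ℂ) T
  rw [AddChar.card_eq] at hmain
  have hsub := card_addSubgroup_le (H := AddChar G ℂ)
  rw [AddChar.card_eq] at hsub
  -- `#Sub(Ĝ) ≤ 2^{4ℓ²}`
  set n := Fintype.card G with hn
  have hn1 : n + 1 ≤ 2 ^ (2 * ℓ) := hG
  have hlog : Nat.log 2 n ≤ 2 * ℓ := by
    rcases Nat.eq_zero_or_pos n with h0 | hpos
    · rw [h0, Nat.log_zero_right]; exact Nat.zero_le _
    · exact Nat.le_of_lt_succ ((Nat.log_lt_iff_lt_pow (by norm_num) hpos.ne').2 (by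
        calc n < 2 ^ (2 * ℓ) := hG
          _ ≤ 2 ^ (2 * ℓ + 1) := Nat.pow_le_pow_right (by norm_num) (by omega)) |>.trans_le le_rfl)
  have hsub' : Nat.card (AddSubgroup (AddChar G ℂ)) ≤ 2 ^ (2 * ℓ * (2 * ℓ)) :=
    calc Nat.card (AddSubgroup (AddChar G ℂ)) ≤ (n + 1) ^ Nat.log 2 n := hsub
      _ ≤ (2 ^ (2 * ℓ)) ^ Nat.log 2 n := Nat.pow_le_pow_left hn1 _
      _ ≤ (2 ^ (2 * ℓ)) ^ (2 * ℓ) := Nat.pow_le_pow_right (by positivity) hlog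
      _ = 2 ^ (2 * ℓ * (2 * ℓ)) := by rw [← pow_mul]
  have h8 := pow_bound_clTrials ℓ
  -- combine: `bad · 2^T ≤ #Sub · n^T ≤ 2^{4ℓ²} n^T` and `8 · 2^{4ℓ²} ≤ 2^T`
  have h1 : bad * 2 ^ T ≤ 2 ^ (2 * ℓ * (2 * ℓ)) * n ^ T :=
    hmain.trans (Nat.mul_le_mul_right _ hsub')
  have h2 : 8 * bad * 2 ^ T ≤ n ^ T * 2 ^ T :=
    calc 8 * bad * 2 ^ T = 8 * (bad * 2 ^ T) := by ring
      _ ≤ 8 * (2 ^ (2 * ℓ * (2 * ℓ)) * n ^ T) := Nat.mul_le_mul_left _ h1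
      _ = (2 ^ (2 * ℓ * (2 * ℓ)) * 8) * n ^ T := by ring
      _ ≤ 2 ^ T * n ^ T := Nat.mul_le_mul_right _ h8
      _ = n ^ T * 2 ^ T := by ring
  exact Nat.le_of_mul_le_mul_right h2 (by positivity)

end Characters

/-! ### The success probability of the experiment -/

section Success

variable {ℓ m : ℕ} {G : Type*} [AddCommGroup G] [Fintype G] [DecidableEq G]

/-- **Success bound for the subgroup-order experiment.** For a clean classical block
`|x⟩|c⟩|0⟩ ↦ |x⟩|c⟩|R c⟩` whose work register separates exactly the trial sums
`∑_{j ∈ trial t} c_j W_j ∈ G` (`W_j = 2^{l_j} g_{i_j}`), and `|G| < 4^ℓ`, every set `E` of control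
read-outs containing all accurate read-outs of all generating character tuples has Born
probability `≥ (7/8)(11/12) = 77/96`: the read-out law is the uniform mixture over `ψ ∈ Ĝ^T` of
product weights (`kitaevCircuit_distributionChar`), generating `ψ` have mass `≥ 7/8`
(`card_not_generating_le`) and accurate read-outs mass `≥ 11/12` under each (`sum_clAccurate_ge`).
[cite: Kitaev1995, §3 (Lemma 10, Thm 1) and §4] -/
theorem subgroupOrder_success (V : QCircuit cliffordT (ℓ + (clNumControls ℓ + m))) (x : QReg ℓ)
    (R : QReg (clNumControls ℓ) → QReg m)
    (hV : ∀ y, V.toMatrix 0 *ᵥ basisState (coinInput x y) = basisState (tri x y (R y)))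
    (g : Fin (clSlots ℓ) → G) (hG : Fintype.card G < clN ℓ)
    (hR : ∀ y y' : QReg (clNumControls ℓ), R y = R y' ↔
      ∀ t, (∑ j ∈ univ.filter (fun j => clTrialOf ℓ j = t), (if y j then clW g j else 0)) =
        ∑ j ∈ univ.filter (fun j => clTrialOf ℓ j = t), (if y' j then clW g j else 0))
    (E : Finset (QReg (clNumControls ℓ)))
    (hE : ∀ ψ : Fin (clTrials ℓ) → AddChar G ℂ, AddSubgroup.closure (Set.range ψ) = ⊤ →
      ∀ γ, ClAccurate g ψ γ → γ ∈ E) :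
    77 / 96 ≤ ∑ γ ∈ E, ∑ ρ : QReg m,
      ‖(kitaevCircuit V (clTypeOf ℓ)).runOn 0 (basisState (padInput x (clNumControls ℓ + m)))
        (tri x γ ρ)‖ ^ 2 := by
  classical
  simp_rw [kitaevCircuit_distributionChar V (clTypeOf ℓ) x R hV (clTrialOf ℓ) (clW g) hR]
  rw [← mul_sum, Fintype.card_fin]
  change 77 / 96 ≤ 1 / (Fintype.card G : ℝ) ^ clTrials ℓ *
    ∑ γ ∈ E, ∑ ψ : Fin (clTrials ℓ) → AddChar G ℂ, ∏ j, clWeight g ψ j (γ j)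
  rw [sum_comm]
  set n := Fintype.card G with hn
  set T := clTrials ℓ with hT
  have hn0 : 0 < n := Fintype.card_pos
  have hrK : (0 : ℝ) < (n : ℝ) ^ T := by positivity
  have hW0 : ∀ (ψ : Fin T → AddChar G ℂ) (γ : Fin (clNumControls ℓ) → Bool),
      0 ≤ ∏ j, clWeight g ψ j (γ j) := fun ψ γ => prod_nonneg fun j _ => clWeight_nonneg g ψ j _
  set good := univ.filter fun ψ : Fin T → AddChar G ℂ => AddSubgroup.closure (Set.range ψ) = ⊤
    with hgood
  have h1 : ∑ ψ ∈ good, (11 / 12 : ℝ) ≤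
      ∑ ψ : Fin T → AddChar G ℂ, ∑ γ ∈ E, ∏ j, clWeight g ψ j (γ j) := by
    calc ∑ ψ ∈ good, (11 / 12 : ℝ)
        ≤ ∑ ψ ∈ good, ∑ γ ∈ E, ∏ j, clWeight g ψ j (γ j) := by
          refine sum_le_sum fun ψ hψ => ?_
          have hψ' : AddSubgroup.closure (Set.range ψ) = ⊤ := (mem_filter.1 hψ).2
          calc (11 / 12 : ℝ) ≤ ∑ γ ∈ univ.filter (fun γ => ClAccurate g ψ γ),
              ∏ j, clWeight g ψ j (γ j) := sum_clAccurate_ge g ψ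
            _ ≤ ∑ γ ∈ E, ∏ j, clWeight g ψ j (γ j) :=
                sum_le_sum_of_subset_of_nonneg (fun γ hγ => hE ψ hψ' γ (mem_filter.1 hγ).2)
                  fun γ _ _ => hW0 ψ γ
      _ ≤ ∑ ψ : Fin T → AddChar G ℂ, ∑ γ ∈ E, ∏ j, clWeight g ψ j (γ j) :=
          sum_le_sum_of_subset_of_nonneg (filter_subset _ _) fun ψ _ _ =>
            sum_nonneg fun γ _ => hW0 ψ γ
  rw [sum_const, nsmul_eq_mul] at h1
  -- `#good ≥ (7/8) n^T`
  have hbad := card_not_generating_le (G := G) hG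
  have hsplit : good.card + (univ.filter fun ψ : Fin T → AddChar G ℂ =>
      AddSubgroup.closure (Set.range ψ) ≠ ⊤).card = n ^ T := by
    rw [hgood, card_filter_add_card_filter_not, card_univ, Fintype.card_pi, prod_const,
      card_univ, Fintype.card_fin, AddChar.card_eq]
  have h2 : 7 / 8 * (n : ℝ) ^ T ≤ good.card := by
    have hb : (8 : ℝ) * ((univ.filter fun ψ : Fin T → AddChar G ℂ =>
        AddSubgroup.closure (Set.range ψ) ≠ ⊤).card : ℝ) ≤ (n : ℝ) ^ T := by exact_mod_cast hbad
    have hs : (good.card : ℝ) + ((univ.filter fun ψ : Fin T → AddChar G ℂ =>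
        AddSubgroup.closure (Set.range ψ) ≠ ⊤).card : ℝ) = (n : ℝ) ^ T := by exact_mod_cast hsplit
    linarith
  have h3 : 7 / 8 * (n : ℝ) ^ T * (11 / 12) ≤
      ∑ ψ : Fin T → AddChar G ℂ, ∑ γ ∈ E, ∏ j, clWeight g ψ j (γ j) :=
    le_trans (mul_le_mul_of_nonneg_right h2 (by norm_num)) h1
  calc (77 / 96 : ℝ) = 1 / (n : ℝ) ^ T * (7 / 8 * (n : ℝ) ^ T * (11 / 12)) := by
        field_simp; ring
    _ ≤ 1 / (n : ℝ) ^ T * ∑ ψ : Fin T → AddChar G ℂ, ∑ γ ∈ E, ∏ j, clWeight g ψ j (γ j) :=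
        mul_le_mul_of_nonneg_left h3 (by positivity)

end Success

end Literature.Computability.Cryptography.Hallgren2005

end
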